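import Literature.NumberTheory.LFunctions.ZetaZeroWindowsExplicit
import Literature.NumberTheory.LFunctions.ZetaArgHSW

/-!
# EarlyAppointments — ζ-side window counts (slot 11a; W-07 C6, cut of `ZetaWindowBudget` rev 5/6 l.1–278)
RH-FREE.  Nothing here bears on the truth of RH; RH is not proved.

For windows `(a, b]` of ordinates near a centre `γ` with `a ≥ 3.0610046·10¹⁰`:
`|N(b) − N(a) − (b − a)/s(γ)| ≤ 2·W₁(2γ) + 1/100`, `s(γ) = 2π/log(γ/2π)` the local mean spacing and
`W₁(T) = 0.1035 log T + 0.2395 log log T + 4.92` the HSW envelope of `S(T)` (`abs_zetaArgS_le_hsw`), from the tree's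
`ZetaZeroWindows.count_diff_le/ge`.  Losses: curvature `(b−a)·D/(2πγ) ≤ 1/400`, `2|S|`, the tree's `2.4/(πT)`.
-/

set_option linter.dupNamespace false  -- D-0017: the mandated namespace `Summit.<S>.<S>.…` repeats `RiemannHypothesis`
namespace Summit.RiemannHypothesis.RiemannHypothesis.Theorems.Splittings.EarlyAppointmentsXiWindowCounts

open Real Literature.NumberTheory.LFunctions

/-- verbatim copy of PACKET rev 5 l.394: the local mean spacing `s(γ) = 2π / log(γ/2π)`. -/
noncomputable def xiSpacing (γ : ℝ) : ℝ := 2 * π / Real.log (γ / (2 * π))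

/-- The Hasanalizade–Shen–Wong envelope of `|S(T)|` (tree `abs_zetaArgS_le_hsw`, `T ≥ 3.0610046·10¹⁰`). -/
noncomputable def W₁ (T : ℝ) : ℝ := 0.1035 * Real.log T + 0.2395 * Real.log (Real.log T) + 4.92

/-- Expand `r / xiSpacing γ` to `(r / 2π) · log(γ / 2π)`. -/
theorem div_xiSpacing (γ r : ℝ) : r / xiSpacing γ = r / (2 * π) * Real.log (γ / (2 * π)) := by
  unfold xiSpacing
  rw [div_div_eq_mul_div]
  ring

/-- Expand `2r / xiSpacing γ` to `(r / π) · log(γ / 2π)`. -/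
theorem two_mul_div_xiSpacing (γ r : ℝ) :
    2 * r / xiSpacing γ = r / π * Real.log (γ / (2 * π)) := by
  rw [div_xiSpacing]
  have hπ : π ≠ 0 := Real.pi_pos.ne'
  field_simp

/-- Curvature of the main term across a window: `log((T+H)/2π) = log(T/2π) + log((T+H)/T)` and `log((T+H)/T) ≤ H/T`. -/
theorem log_window_split {T H : ℝ} (hT : 0 < T) (hH : 0 ≤ H) :
    Real.log ((T + H) / (2 * π)) = Real.log (T / (2 * π)) + Real.log ((T + H) / T) := by
  have hπ := Real.pi_pos
  rw [← Real.log_mul (by positivity) (by positivity)]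
  congr 1
  field_simp

/-- `log((T+H)/T) ≤ H/T` for `T > 0`, `H ≥ 0`. -/
theorem log_window_le {T H : ℝ} (hT : 0 < T) (hH : 0 ≤ H) : Real.log ((T + H) / T) ≤ H / T := by
  have h := Real.log_le_sub_one_of_pos (show 0 < (T + H) / T by positivity)
  have e : (T + H) / T - 1 = H / T := by field_simp; ring
  rwa [e] at h

/-- **COLUMN, UPPER (ζ-side)**: `N(γ+r) − N(γ−r) − 2r/s(γ) ≤ |S(γ+r)| + |S(γ−r)| + r²/(πγ) + 2.4/(π(γ−r))`, `γ − r ≥ 2`, `r ≥ 0`. -/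
theorem column_count_le {γ r : ℝ} (hγ : 2 ≤ γ - r) (hr : 0 ≤ r) :
    (zetaZeroCount (γ + r) : ℝ) - zetaZeroCount (γ - r) - 2 * r / xiSpacing γ ≤
      |zetaArgS (γ + r)| + |zetaArgS (γ - r)| + r ^ 2 / (π * γ) + 2.4 / (π * (γ - r)) := by
  have hπ := Real.pi_pos
  have hγ0 : 0 < γ := by linarith
  have h := ZetaZeroWindows.count_diff_le (T := γ - r) (H := 2 * r) hγ (by linarith)
  rw [show γ - r + 2 * r = γ + r by ring] at h
  -- main term: log((γ+r)/2π) = log(γ/2π) + log((γ+r)/γ) ≤ log(γ/2π) + r/γ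
  have hs := log_window_split (T := γ) (H := r) hγ0 hr
  have hl := log_window_le (T := γ) (H := r) hγ0 hr
  have hkey : 2 * r / (2 * π) * Real.log ((γ + r) / (2 * π)) ≤
      r / π * Real.log (γ / (2 * π)) + r ^ 2 / (π * γ) := by
    rw [hs, show 2 * r / (2 * π) = r / π by field_simp, mul_add]
    have h1 : r / π * Real.log ((γ + r) / γ) ≤ r / π * (r / γ) :=
      mul_le_mul_of_nonneg_left hl (by positivity)
    have h2 : r / π * (r / γ) = r ^ 2 / (π * γ) := by
      field_simp
    linarith [h1, h2]
  rw [two_mul_div_xiSpacing]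
  linarith [hkey, h]

/-- **COLUMN, UPPER, HSW envelope**: for `γ − r ≥ 3.0610046·10¹⁰`. -/
theorem column_count_le_hsw {γ r : ℝ} (hγ : 30610046000 ≤ γ - r) (hr : 0 ≤ r) :
    (zetaZeroCount (γ + r) : ℝ) - zetaZeroCount (γ - r) - 2 * r / xiSpacing γ ≤
      W₁ (γ + r) + W₁ (γ - r) + r ^ 2 / (π * γ) + 2.4 / (π * (γ - r)) := by
  have h := column_count_le (γ := γ) (r := r) (by linarith) hr
  have h1 := abs_zetaArgS_le_hsw (T := γ + r) (by linarith)
  have h2 := abs_zetaArgS_le_hsw (T := γ - r) hγ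
  unfold W₁
  linarith

/-- **RIGHT HALF-SLAB `(γ, γ+r]`, two-sided (ζ-side)**:
`−(|S(γ+r)| + |S(γ)| + 2.4/(πγ)) ≤ N(γ+r) − N(γ) − r/s(γ) ≤ |S(γ+r)| + |S(γ)| + r²/(2πγ) + 2.4/(πγ)`. -/
theorem rightSlab_count_le {γ r : ℝ} (hγ : 2 ≤ γ) (hr : 0 ≤ r) :
    (zetaZeroCount (γ + r) : ℝ) - zetaZeroCount γ - r / xiSpacing γ ≤
      |zetaArgS (γ + r)| + |zetaArgS γ| + r ^ 2 / (2 * π * γ) + 2.4 / (π * γ) := by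
  have hπ := Real.pi_pos
  have hγ0 : 0 < γ := by linarith
  have h := ZetaZeroWindows.count_diff_le (T := γ) (H := r) hγ hr
  have hs := log_window_split (T := γ) (H := r) hγ0 hr
  have hl := log_window_le (T := γ) (H := r) hγ0 hr
  have hkey : r / (2 * π) * Real.log ((γ + r) / (2 * π)) ≤
      r / (2 * π) * Real.log (γ / (2 * π)) + r ^ 2 / (2 * π * γ) := by
    rw [hs, mul_add]
    have h1 : r / (2 * π) * Real.log ((γ + r) / γ) ≤ r / (2 * π) * (r / γ) :=
      mul_le_mul_of_nonneg_left hl (by positivity)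
    have h2 : r / (2 * π) * (r / γ) = r ^ 2 / (2 * π * γ) := by
      field_simp
    linarith [h1, h2]
  rw [div_xiSpacing]
  linarith [hkey, h]

/-- **RIGHT HALF-SLAB `(γ, γ+r]`, LOWER**: `N(γ+r) − N(γ) − r/s(γ) ≥ −(|S(γ+r)| + |S(γ)| + 2.4/(πγ))`. -/
theorem rightSlab_count_ge {γ r : ℝ} (hγ : 2 ≤ γ) (hr : 0 ≤ r) :
    -(|zetaArgS (γ + r)| + |zetaArgS γ| + 2.4 / (π * γ)) ≤
      (zetaZeroCount (γ + r) : ℝ) - zetaZeroCount γ - r / xiSpacing γ := by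
  have h := ZetaZeroWindows.count_diff_ge (T := γ) (H := r) hγ hr
  rw [div_xiSpacing]
  linarith [h]

/-- **LEFT HALF-SLAB `(γ−r, γ]`, two-sided (ζ-side)**:
`−(|S(γ)| + |S(γ−r)| + r²/(2π(γ−r)) + 2.4/(π(γ−r))) ≤ N(γ) − N(γ−r) − r/s(γ) ≤ |S(γ)| + |S(γ−r)| + 2.4/(π(γ−r))`. -/
theorem leftSlab_count_le {γ r : ℝ} (hγ : 2 ≤ γ - r) (hr : 0 ≤ r) :
    (zetaZeroCount γ : ℝ) - zetaZeroCount (γ - r) - r / xiSpacing γ ≤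
      |zetaArgS γ| + |zetaArgS (γ - r)| + 2.4 / (π * (γ - r)) := by
  have h := ZetaZeroWindows.count_diff_le (T := γ - r) (H := r) hγ hr
  rw [show γ - r + r = γ by ring] at h
  rw [div_xiSpacing]
  linarith [h]

/-- **LEFT HALF-SLAB `(γ−r, γ]`, LOWER**: `N(γ) − N(γ−r) − r/s(γ) ≥ −(|S(γ)| + |S(γ−r)| + r²/(2π(γ−r)) + 2.4/(π(γ−r)))`. -/
theorem leftSlab_count_ge {γ r : ℝ} (hγ : 2 ≤ γ - r) (hr : 0 ≤ r) :
    -(|zetaArgS γ| + |zetaArgS (γ - r)| + r ^ 2 / (2 * π * (γ - r)) + 2.4 / (π * (γ - r))) ≤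
      (zetaZeroCount γ : ℝ) - zetaZeroCount (γ - r) - r / xiSpacing γ := by
  have hπ := Real.pi_pos
  have hγ0 : 0 < γ - r := by linarith
  have h := ZetaZeroWindows.count_diff_ge (T := γ - r) (H := r) hγ hr
  rw [show γ - r + r = γ by ring] at h
  -- main term from below: log((γ−r)/2π) = log(γ/2π) − log(γ/(γ−r)) ≥ log(γ/2π) − r/(γ−r)
  have hs := log_window_split (T := γ - r) (H := r) hγ0 hr
  have hl := log_window_le (T := γ - r) (H := r) hγ0 hr
  rw [show γ - r + r = γ by ring] at hs hl
  have hkey : r / (2 * π) * Real.log (γ / (2 * π)) - r ^ 2 / (2 * π * (γ - r)) ≤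
      r / (2 * π) * Real.log ((γ - r) / (2 * π)) := by
    rw [hs, mul_add]
    have h1 : r / (2 * π) * Real.log (γ / (γ - r)) ≤ r / (2 * π) * (r / (γ - r)) :=
      mul_le_mul_of_nonneg_left hl (by positivity)
    have h2 : r / (2 * π) * (r / (γ - r)) = r ^ 2 / (2 * π * (γ - r)) := by
      field_simp
    linarith [h1, h2]
  rw [div_xiSpacing]
  linarith [hkey, h]

/-- **HALF-SLABS, HSW envelope** (the four bounds with `|S| ≤ W₁`), `γ − r ≥ 3.0610046·10¹⁰`, `0 ≤ r`. -/
theorem halfSlab_count_abs_le_hsw {γ r : ℝ} (hγ : 30610046000 ≤ γ - r) (hr : 0 ≤ r) :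
    |(zetaZeroCount (γ + r) : ℝ) - zetaZeroCount γ - r / xiSpacing γ| ≤
        W₁ (γ + r) + W₁ γ + r ^ 2 / (2 * π * γ) + 2.4 / (π * γ) ∧
    |(zetaZeroCount γ : ℝ) - zetaZeroCount (γ - r) - r / xiSpacing γ| ≤
        W₁ γ + W₁ (γ - r) + r ^ 2 / (2 * π * (γ - r)) + 2.4 / (π * (γ - r)) := by
  have hπ := Real.pi_pos
  have hγ2 : 2 ≤ γ := by linarith
  have hγ0 : 0 < γ := by linarith
  have hγr : 0 < γ - r := by linarith
  have a1 := rightSlab_count_le hγ2 hr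
  have a2 := rightSlab_count_ge hγ2 hr
  have a3 := leftSlab_count_le (γ := γ) (r := r) (by linarith) hr
  have a4 := leftSlab_count_ge (γ := γ) (r := r) (by linarith) hr
  have s1 := abs_zetaArgS_le_hsw (T := γ + r) (by linarith)
  have s2 := abs_zetaArgS_le_hsw (T := γ) (by linarith)
  have s3 := abs_zetaArgS_le_hsw (T := γ - r) hγ
  have p1 : 0 ≤ r ^ 2 / (2 * π * γ) := by positivity
  have p2 : 0 ≤ r ^ 2 / (2 * π * (γ - r)) := by positivity
  unfold W₁
  constructor <;> rw [abs_le] <;> constructor <;> linarith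

/-- `W₁` is monotone for `x > 1`. -/
theorem W₁_mono {x y : ℝ} (hx : 1 < x) (hxy : x ≤ y) : W₁ x ≤ W₁ y := by
  have h1 : Real.log x ≤ Real.log y := Real.log_le_log (by linarith) hxy
  have hlx : 0 < Real.log x := Real.log_pos hx
  have h2 : Real.log (Real.log x) ≤ Real.log (Real.log y) := Real.log_le_log hlx h1
  unfold W₁
  linarith [mul_le_mul_of_nonneg_left h1 (by norm_num : (0:ℝ) ≤ 0.1035),
    mul_le_mul_of_nonneg_left h2 (by norm_num : (0:ℝ) ≤ 0.2395)]

/-- **COLUMN vs the booked profile**: for `γ − r ≥ 3.0610046·10¹⁰` and `0 ≤ r ≤ 68` (the booked radii are `R γ/2 ≤ 34` t-units; any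
`r ≤ 68` is covered), `N(γ+r) − N(γ−r) − 2r/s(γ) ≤ 2·W₁(2γ) + 1/100`, i.e. within C1's `B γ = ⌈2·W₁(2γ) + 1/100⌉₊`. -/
theorem column_count_le_TB {γ r : ℝ} (hγ : 30610046000 ≤ γ - r) (hr : 0 ≤ r) (hr68 : r ≤ 68) :
    (zetaZeroCount (γ + r) : ℝ) - zetaZeroCount (γ - r) - 2 * r / xiSpacing γ ≤ 2 * W₁ (2 * γ) + 1 / 100 := by
  have hπ := Real.pi_gt_three
  have h := column_count_le_hsw hγ hr
  have hγ0 : 0 < γ := by linarith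
  have w1 : W₁ (γ + r) ≤ W₁ (2 * γ) := W₁_mono (by linarith) (by linarith)
  have w2 : W₁ (γ - r) ≤ W₁ (2 * γ) := W₁_mono (by linarith) (by linarith)
  have e1 : r ^ 2 / (π * γ) ≤ 1 / 200 := by
    rw [div_le_iff₀ (by positivity)]
    nlinarith
  have e2 : 2.4 / (π * (γ - r)) ≤ 1 / 200 := by
    rw [div_le_iff₀ (by nlinarith)]
    nlinarith
  linarith

/-- **HALF-SLABS vs the booked profile**: both absolute half-slab discrepancies are `≤ 2·W₁(2γ) + 1/100 ≤ B γ ≤ 1 + B γ`. -/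
theorem halfSlab_count_abs_le_TB {γ r : ℝ} (hγ : 30610046000 ≤ γ - r) (hr : 0 ≤ r) (hr68 : r ≤ 68) :
    |(zetaZeroCount (γ + r) : ℝ) - zetaZeroCount γ - r / xiSpacing γ| ≤ 2 * W₁ (2 * γ) + 1 / 100 ∧
    |(zetaZeroCount γ : ℝ) - zetaZeroCount (γ - r) - r / xiSpacing γ| ≤ 2 * W₁ (2 * γ) + 1 / 100 := by
  have hπ := Real.pi_gt_three
  obtain ⟨a, b⟩ := halfSlab_count_abs_le_hsw hγ hr
  have hγ0 : 0 < γ := by linarith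
  have w1 : W₁ (γ + r) ≤ W₁ (2 * γ) := W₁_mono (by linarith) (by linarith)
  have w2 : W₁ (γ - r) ≤ W₁ (2 * γ) := W₁_mono (by linarith) (by linarith)
  have w3 : W₁ γ ≤ W₁ (2 * γ) := W₁_mono (by linarith) (by linarith)
  have e1 : r ^ 2 / (2 * π * γ) ≤ 1 / 200 := by
    rw [div_le_iff₀ (by positivity)]
    nlinarith
  have e1' : r ^ 2 / (2 * π * (γ - r)) ≤ 1 / 200 := by
    rw [div_le_iff₀ (by nlinarith)]
    nlinarith
  have e2 : 2.4 / (π * γ) ≤ 1 / 200 := by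
    rw [div_le_iff₀ (by positivity)]
    nlinarith
  have e2' : 2.4 / (π * (γ - r)) ≤ 1 / 200 := by
    rw [div_le_iff₀ (by nlinarith)]
    nlinarith
  exact ⟨by linarith, by linarith⟩

/-- **ANY WINDOW `(a, b]` within `136` of the centre `γ`, against `s(γ)`**: `|N(b) − N(a) − (b−a)/s(γ)| ≤ 2·W₁(2γ) + 1/100`
for `3.0610046·10¹⁰ ≤ a ≤ b`, `γ − 136 ≤ a`, `b ≤ γ + 136`. -/
theorem window_count_abs_le_TB {γ a b : ℝ} (ha : 30610046000 ≤ a) (hab : a ≤ b) (hγa : γ - 136 ≤ a)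
    (hbγ : b ≤ γ + 136) :
    |(zetaZeroCount b : ℝ) - zetaZeroCount a - (b - a) / xiSpacing γ| ≤ 2 * W₁ (2 * γ) + 1 / 100 := by
  have hπ := Real.pi_gt_three
  have hπ0 := Real.pi_pos
  have ha0 : 0 < a := by linarith
  have hγ0 : 0 < γ := by linarith
  have hb0 : 0 < b := by linarith
  have hH : 0 ≤ b - a := by linarith
  have hup := ZetaZeroWindows.count_diff_le (T := a) (H := b - a) (by linarith) hH
  have hlo := ZetaZeroWindows.count_diff_ge (T := a) (H := b - a) (by linarith) hH
  rw [show a + (b - a) = b by ring] at hup hlo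
  have s1 := abs_zetaArgS_le_hsw (T := a) ha
  have s2 := abs_zetaArgS_le_hsw (T := b) (by linarith)
  have w1 : W₁ a ≤ W₁ (2 * γ) := W₁_mono (by linarith) (by linarith)
  have w2 : W₁ b ≤ W₁ (2 * γ) := W₁_mono (by linarith) (by linarith)
  -- main terms against log(γ/2π)
  have eb : Real.log (b / (2 * π)) = Real.log (γ / (2 * π)) + Real.log (b / γ) := by
    rw [← Real.log_mul (by positivity) (by positivity)]; congr 1; field_simp
  have ea : Real.log (a / (2 * π)) = Real.log (γ / (2 * π)) + Real.log (a / γ) := by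
    rw [← Real.log_mul (by positivity) (by positivity)]; congr 1; field_simp
  have lb : Real.log (b / γ) ≤ 136 / γ := by
    have h := Real.log_le_sub_one_of_pos (show 0 < b / γ by positivity)
    have e : b / γ - 1 = (b - γ) / γ := by field_simp
    rw [e] at h
    exact h.trans (div_le_div_of_nonneg_right (by linarith) hγ0.le)
  have la : -(136 / a) ≤ Real.log (a / γ) := by
    have h := Real.one_sub_inv_le_log_of_pos (show 0 < a / γ by positivity)
    have e : 1 - (a / γ)⁻¹ = -((γ - a) / a) := by field_simp; ring
    rw [e] at h
    have : (γ - a) / a ≤ 136 / a := div_le_div_of_nonneg_right (by linarith) ha0.le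
    linarith
  have hsp := div_xiSpacing γ (b - a)
  -- curvature losses ≤ 1/400 each, Stirling term ≤ 1/400
  have c1 : (b - a) / (2 * π) * (136 / γ) ≤ 1 / 400 := by
    rw [show (b - a) / (2 * π) * (136 / γ) = (b - a) * 136 / (2 * π * γ) by field_simp]
    rw [div_le_iff₀ (by positivity)]; nlinarith
  have c2 : (b - a) / (2 * π) * (136 / a) ≤ 1 / 400 := by
    rw [show (b - a) / (2 * π) * (136 / a) = (b - a) * 136 / (2 * π * a) by field_simp]
    rw [div_le_iff₀ (by positivity)]; nlinarith
  have c3 : 2.4 / (π * a) ≤ 1 / 400 := by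
    rw [div_le_iff₀ (by positivity)]; nlinarith
  have m1 : (b - a) / (2 * π) * Real.log (b / (2 * π)) ≤ (b - a) / xiSpacing γ + 1 / 400 := by
    rw [hsp, eb, mul_add]
    have := mul_le_mul_of_nonneg_left lb (show 0 ≤ (b - a) / (2 * π) by positivity)
    linarith
  have m2 : (b - a) / xiSpacing γ - 1 / 400 ≤ (b - a) / (2 * π) * Real.log (a / (2 * π)) := by
    rw [hsp, ea, mul_add]
    have := mul_le_mul_of_nonneg_left la (show 0 ≤ (b - a) / (2 * π) by positivity)
    linarith
  unfold W₁ at *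
  rw [abs_le]; constructor <;> linarith

end Summit.RiemannHypothesis.RiemannHypothesis.Theorems.Splittings.EarlyAppointmentsXiWindowCounts
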